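import Summits.AtomisticToContinuum.Crystallization.Theorems.ThreeConeCertificateSlackRigidityRodLemmaC

/-!
# The 1-D spectral lemma of line `signed-root-silent-field` — part D: vanishing jets; the
# sampling function `Q₀`

The registered stub `stub_rodLemma` (skeleton `Cruxes/SlackRigidity/Lines/signed-root-silent-field.lean`,
lead c2; crux `SlackRigidity`, stmt-AtomisticToContinuum-11960): a bounded sequence `u : ℤ → ℂ` with
`Σ_k u_k c(t − kh) = 0` for all real `t`, where `c` is continuous, `O((1+|t|)⁻²)`, and `𝓕c` is `C²`
and zero-free on `(1/(2h), 1/h) ∪ (−1/h, −1/(2h))`, is `2`-periodic.  Proof WITHOUT Wiener division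
or distributions: test the identity against `𝓕(φ/𝓕c)` (multiplication formula) to annihilate every
`C_c²` test function supported in a good interval; integer translates of the two good intervals cover
`ℝ ∖ ½ℤ`; shrinking bumps extend the annihilation to test functions with vanishing `2`-jets on `½ℤ`;
pairing with `𝐞(k₀·)(𝐞(2·) − 1)³ Q₀` (`𝓕Q₀|_ℤ = q δ₀`) gives a vanishing third difference of
`n ↦ u(k₀ + 2n)`, and a bounded sequence with vanishing third difference is constant.
All `[folklore]` (Rudin, *Functional Analysis* Thm 9.3; Katznelson, *Harmonic Analysis* Ch. VI).

This part: annihilation of `C_c²` test functions with vanishing `2`-jets on `½ℤ`, and the sampling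
function `Q₀ = S(·+½) − S(·−½)`: smooth, compactly supported, nonnegative, `𝓕Q₀(0) ≠ 0`.
-/

noncomputable section

open scoped BigOperators Topology FourierTransform Real
open MeasureTheory Filter Set Complex

namespace Summit.AtomisticToContinuum.Crystallization.Theorems.SignedRootRodLemma

/-- Distinct half-integers are at distance at least `1/2`. [folklore] -/
theorem half_le_abs_sub_of_ne {m m' : ℤ} (h : m ≠ m') : (1 : ℝ) / 2 ≤ |(m : ℝ) / 2 - (m' : ℝ) / 2| := by
  have h1 : (1 : ℤ) ≤ |m - m'| := Int.one_le_abs (sub_ne_zero.2 h)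
  have h2 : (1 : ℝ) ≤ |((m - m' : ℤ) : ℝ)| := by
    rw [← Int.cast_abs]; exact_mod_cast h1
  rw [show (m : ℝ) / 2 - (m' : ℝ) / 2 = ((m - m' : ℤ) : ℝ) / 2 by push_cast; ring, abs_div,
    abs_of_pos (by norm_num : (0 : ℝ) < 2)]
  linarith

/-- Linearity of `𝓕` at a point over a finite sum of integrable functions plus one more. [folklore] -/
theorem fourier_add_sum_apply {ι : Type*} (s : Finset ι) {f : ℝ → ℂ} {g : ι → ℝ → ℂ}
    (hf : Integrable f) (hg : ∀ i ∈ s, Integrable (g i)) (w : ℝ) :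
    𝓕 (fun x => f x + ∑ i ∈ s, g i x) w = 𝓕 f w + ∑ i ∈ s, 𝓕 (g i) w := by
  classical
  have hint : ∀ (q : ℝ → ℂ), Integrable q → Integrable (fun v : ℝ => 𝐞 (-(v * w)) • q v) := by
    intro q hq
    have h := (Real.fourierIntegral_convergent_iff (μ := volume) (f := q) w).2 hq
    simp only [Real.inner_apply] at h
    simpa [mul_comm] using h
  simp only [Real.fourier_real_eq]
  have e : (fun v : ℝ => 𝐞 (-(v * w)) • (f v + ∑ i ∈ s, g i v)) =
      fun v => 𝐞 (-(v * w)) • f v + ∑ i ∈ s, 𝐞 (-(v * w)) • g i v := by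
    funext v; rw [smul_add, Finset.smul_sum]
  rw [e, integral_add (hint f hf) (integrable_finsetSum _ fun i hi => hint _ (hg i hi)),
    integral_finsetSum _ fun i hi => hint _ (hg i hi)]

/-- **Annihilation for test functions with vanishing `2`-jets on the half-integer grid.**  Under the
standing hypotheses (`h = 1`), `Σ_k u_k 𝓕φ(k) = 0` for every `φ ∈ C_c²` with
`φ = φ' = φ'' = 0` at every point of `½ℤ`: cut out shrinking bumps at the grid points meeting the
support, annihilate the grid-avoiding remainder, and let the bumps shrink. [folklore] -/
theorem hasSum_mul_fourier_of_jets {u : ℤ → ℂ} {c : ℝ → ℂ} {M C : ℝ}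
    (hu : ∀ k, ‖u k‖ ≤ M) (hc : Continuous c) (hcd : ∀ t : ℝ, ‖c t‖ ≤ C / (1 + |t|) ^ 2)
    (hsum : ∀ t : ℝ, HasSum (fun k : ℤ => u k * c (t - k)) 0)
    (hm : ContDiffOn ℝ 2 (𝓕 c) (Set.Ioo (1 / 2 : ℝ) 1 ∪ Set.Ioo (-1 : ℝ) (-(1 / 2))))
    (hm0 : ∀ ξ ∈ Set.Ioo (1 / 2 : ℝ) 1 ∪ Set.Ioo (-1 : ℝ) (-(1 / 2)), 𝓕 c ξ ≠ 0)
    {φ : ℝ → ℂ} (hφ : ContDiff ℝ 2 φ) (hφs : HasCompactSupport φ)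
    (hj : ∀ m : ℤ, φ ((m : ℝ) / 2) = 0 ∧ deriv φ ((m : ℝ) / 2) = 0 ∧
      deriv (deriv φ) ((m : ℝ) / 2) = 0) :
    HasSum (fun k : ℤ => u k * 𝓕 φ k) 0 := by
  classical
  have hM : 0 ≤ M := (norm_nonneg _).trans (hu 0)
  -- summability of the target series
  obtain ⟨hsφ, -⟩ := summable_norm_fourier_int_and_tsum_le hφ hφs
  have hsum_u : Summable (fun k : ℤ => u k * 𝓕 φ k) :=
    Summable.of_norm_bounded (hsφ.mul_left M) fun k => by
      rw [norm_mul]; exact mul_le_mul_of_nonneg_right (hu k) (norm_nonneg _)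
  -- it suffices to bound the norm of the sum by every `ε > 0`
  suffices key : ∀ ε : ℝ, 0 < ε → ‖∑' k : ℤ, u k * 𝓕 φ k‖ ≤ ε by
    have h0 : ∑' k : ℤ, u k * 𝓕 φ k = 0 := by
      by_contra hne
      have hpos : 0 < ‖∑' k : ℤ, u k * 𝓕 φ k‖ := norm_pos_iff.2 hne
      have := key (‖∑' k : ℤ, u k * 𝓕 φ k‖ / 2) (by positivity)
      linarith
    rw [← h0]; exact hsum_u.hasSum
  intro ε hε
  -- support radius and the finite grid `P` of half-integers `m/2`, `|m| ≤ N'`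
  obtain ⟨R, hR⟩ := hφs.isCompact.isBounded.subset_closedBall (0 : ℝ)
  set N' : ℤ := ⌈2 * |R| + 4⌉ with hN'
  have hN'R : 2 * |R| + 4 ≤ N' := Int.le_ceil _
  set P : Finset ℝ := (Finset.Icc (-N') N').image (fun m : ℤ => (m : ℝ) / 2) with hP
  -- thresholds for the shrinking bumps
  set ε'' : ℝ := ε / (P.card * (M * (2 * S₀)) + 1) with hε''
  have hden : 0 < (P.card : ℝ) * (M * (2 * S₀)) + 1 := by
    have := S₀_nonneg; positivity
  have hε''0 : 0 < ε'' := div_pos hε hden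
  have hthr : ∀ p ∈ P, ∃ N₀ : ℕ, ∀ N : ℕ, N₀ ≤ N →
      (∫ x, ‖φ x * bumpAt N p x‖) + ∫ x, ‖deriv (deriv (fun y => φ y * bumpAt N p y)) x‖ ≤ ε'' := by
    intro p hp
    obtain ⟨m, -, rfl⟩ := Finset.mem_image.1 hp
    obtain ⟨h0, h1, h2⟩ := hj m
    exact shrinking_bump hφ h0 h1 h2 hε''0
  choose! N₀ hN₀ using hthr
  set N : ℕ := max (P.sup N₀) 8 with hNdef
  have hN8 : (8 : ℝ) ≤ N := by exact_mod_cast le_max_right _ _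
  have hNpos : (0 : ℝ) < N := by linarith
  have hNP : ∀ p ∈ P, N₀ p ≤ N := fun p hp => (Finset.le_sup hp).trans (le_max_left _ _)
  -- the decomposition `φ = φ₁ + Σ_p g_p`
  set ρ : ℝ → ℂ := fun x => ∑ p ∈ P, bumpAt N p x with hρ
  set φ₁ : ℝ → ℂ := fun x => φ x * (1 - ρ x) with hφ₁
  set gp : ℝ → ℝ → ℂ := fun p x => φ x * bumpAt N p x with hgp
  have hdecomp : ∀ x, φ x = φ₁ x + ∑ p ∈ P, gp p x := by
    intro x
    rw [hφ₁, hgp, hρ]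
    simp only
    rw [← Finset.mul_sum]
    ring
  -- regularity
  have hρd : ContDiff ℝ 2 ρ := ContDiff.sum fun p _ => contDiff_bumpAt (N : ℝ) p
  have hφ₁d : ContDiff ℝ 2 φ₁ := hφ.mul (contDiff_const.sub hρd)
  have hφ₁s : HasCompactSupport φ₁ := hφs.mul_right
  have hgpd : ∀ p, ContDiff ℝ 2 (gp p) := fun p => hφ.mul (contDiff_bumpAt (N : ℝ) p)
  have hgps : ∀ p, HasCompactSupport (gp p) := fun p => (hasCompactSupport_bumpAt hNpos p).mul_left
  have hφ₁i : Integrable φ₁ := hφ₁d.continuous.integrable_of_hasCompactSupport hφ₁s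
  have hgpi : ∀ p, Integrable (gp p) := fun p =>
    (hgpd p).continuous.integrable_of_hasCompactSupport (hgps p)
  -- `φ₁` avoids the grid
  have havoid : ∀ x ∈ tsupport φ₁, ∀ m : ℤ, x ≠ (m : ℝ) / 2 := by
    intro x hx m hxm
    apply (notMem_tsupport_iff_eventuallyEq.2 ?_) hx
    rw [hxm]
    by_cases hmP : (m : ℝ) / 2 ∈ P
    · -- `ρ = 1` near `m/2`
      have hρ1 : ∀ y : ℝ, |y - (m : ℝ) / 2| < 1 / N → ρ y = 1 := by
        intro y hy
        rw [hρ]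
        simp only
        rw [Finset.sum_eq_single_of_mem ((m : ℝ) / 2) hmP]
        · exact bumpAt_eq_one hNpos hy.le
        · intro p hp hne
          obtain ⟨m', -, rfl⟩ := Finset.mem_image.1 hp
          have hmm' : m' ≠ m := fun h => hne (by rw [h])
          have hfar : (1 : ℝ) / 2 ≤ |(m' : ℝ) / 2 - (m : ℝ) / 2| := half_le_abs_sub_of_ne hmm'
          refine bumpAt_eq_zero_of_le hNpos ?_
          have htri : |(m' : ℝ) / 2 - (m : ℝ) / 2| ≤ |y - (m' : ℝ) / 2| + |y - (m : ℝ) / 2| := by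
            calc |(m' : ℝ) / 2 - (m : ℝ) / 2| = |(y - (m : ℝ) / 2) - (y - (m' : ℝ) / 2)| := by ring_nf
              _ ≤ |y - (m : ℝ) / 2| + |y - (m' : ℝ) / 2| := abs_sub _ _
              _ = |y - (m' : ℝ) / 2| + |y - (m : ℝ) / 2| := add_comm _ _
          have h3 : (3 : ℝ) / N ≤ 1 / 2 := by
            rw [div_le_iff₀ hNpos]; linarith
          have h1N : 1 / (N : ℝ) + 2 / N = 3 / N := by ring
          linarith
      filter_upwards [Metric.ball_mem_nhds ((m : ℝ) / 2) (by positivity : (0 : ℝ) < 1 / N)] with y hy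
      rw [Metric.mem_ball, Real.dist_eq] at hy
      rw [hφ₁]
      simp only [Pi.zero_apply]
      rw [hρ1 y hy, sub_self, mul_zero]
    · -- `m/2` is far from the support of `φ`
      have hmfar : |R| + 2 < |(m : ℝ) / 2| := by
        have hmI : m ∉ Finset.Icc (-N') N' := by
          intro h
          exact hmP (Finset.mem_image.2 ⟨m, h, rfl⟩)
        rw [Finset.mem_Icc, not_and_or, not_le, not_le] at hmI
        have hm' : (N' : ℝ) < |(m : ℝ)| := by
          rcases hmI with h | h
          · have : (m : ℝ) < -N' := by exact_mod_cast h
            have : (N' : ℝ) < -m := by linarith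
            exact this.trans_le (neg_le_abs _)
          · have : (N' : ℝ) < m := by exact_mod_cast h
            exact this.trans_le (le_abs_self _)
        rw [abs_div, abs_of_pos (by norm_num : (0 : ℝ) < 2)]
        linarith
      filter_upwards [Metric.ball_mem_nhds ((m : ℝ) / 2) one_pos] with y hy
      rw [Metric.mem_ball, Real.dist_eq] at hy
      have hyR : y ∉ tsupport φ := by
        intro h
        have hyR' : ‖y‖ ≤ R := by simpa using hR h
        rw [Real.norm_eq_abs] at hyR'
        have : |(m : ℝ) / 2| ≤ |y| + |y - (m : ℝ) / 2| := by
          calc |(m : ℝ) / 2| = |y - (y - (m : ℝ) / 2)| := by ring_nf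
            _ ≤ |y| + |y - (m : ℝ) / 2| := abs_sub _ _
        linarith [le_abs_self R]
      rw [hφ₁]
      simp only [Pi.zero_apply]
      rw [image_eq_zero_of_notMem_tsupport hyR, zero_mul]
  -- annihilation of `φ₁`
  have hA₁ : HasSum (fun k : ℤ => u k * 𝓕 φ₁ k) 0 :=
    hasSum_mul_fourier_of_avoid_grid hu hc hcd hsum hm hm0 hφ₁d hφ₁s havoid
  -- the bump pieces: summable, with small sums
  have hpiece : ∀ p ∈ P, Summable (fun k : ℤ => u k * 𝓕 (gp p) k) ∧
      ‖∑' k : ℤ, u k * 𝓕 (gp p) k‖ ≤ M * (2 * S₀) * ε'' := by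
    intro p hp
    obtain ⟨hs, hle⟩ := summable_norm_fourier_int_and_tsum_le (hgpd p) (hgps p)
    have hsu : Summable (fun k : ℤ => ‖u k * 𝓕 (gp p) k‖) :=
      (hs.mul_left M).of_nonneg_of_le (fun k => norm_nonneg _) fun k => by
        rw [norm_mul]; exact mul_le_mul_of_nonneg_right (hu k) (norm_nonneg _)
    refine ⟨hsu.of_norm, ?_⟩
    have hA := hN₀ p hp N (hNP p hp)
    calc ‖∑' k : ℤ, u k * 𝓕 (gp p) k‖ ≤ ∑' k : ℤ, ‖u k * 𝓕 (gp p) k‖ := norm_tsum_le_tsum_norm hsu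
      _ ≤ ∑' k : ℤ, M * ‖𝓕 (gp p) k‖ := hsu.tsum_le_tsum (fun k => by
          rw [norm_mul]; exact mul_le_mul_of_nonneg_right (hu k) (norm_nonneg _)) (hs.mul_left M)
      _ = M * ∑' k : ℤ, ‖𝓕 (gp p) k‖ := tsum_mul_left
      _ ≤ M * (2 * S₀ * ((∫ t, ‖gp p t‖) + ∫ t, ‖deriv (deriv (gp p)) t‖)) :=
          mul_le_mul_of_nonneg_left hle hM
      _ ≤ M * (2 * S₀ * ε'') := by
          have := S₀_nonneg
          gcongr
      _ = M * (2 * S₀) * ε'' := by ring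
  -- linearity of `𝓕` and of the series
  have hF : ∀ k : ℤ, 𝓕 φ k = 𝓕 φ₁ k + ∑ p ∈ P, 𝓕 (gp p) k := by
    intro k
    have e : φ = fun x => φ₁ x + ∑ p ∈ P, gp p x := funext hdecomp
    rw [e]
    exact fourier_add_sum_apply P hφ₁i (fun p _ => hgpi p) k
  have hS : HasSum (fun k : ℤ => u k * 𝓕 φ₁ k + ∑ p ∈ P, u k * 𝓕 (gp p) k)
      (0 + ∑ p ∈ P, ∑' k : ℤ, u k * 𝓕 (gp p) k) :=
    hA₁.add (hasSum_sum fun p hp => (hpiece p hp).1.hasSum)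
  have hfun : (fun k : ℤ => u k * 𝓕 φ₁ k + ∑ p ∈ P, u k * 𝓕 (gp p) k) =
      fun k : ℤ => u k * 𝓕 φ k := by
    funext k
    rw [hF k, mul_add, Finset.mul_sum]
  rw [hfun, zero_add] at hS
  rw [hS.tsum_eq]
  -- the final estimate
  calc ‖∑ p ∈ P, ∑' k : ℤ, u k * 𝓕 (gp p) k‖ ≤ ∑ p ∈ P, ‖∑' k : ℤ, u k * 𝓕 (gp p) k‖ :=
        norm_sum_le _ _
    _ ≤ ∑ p ∈ P, M * (2 * S₀) * ε'' := Finset.sum_le_sum fun p hp => (hpiece p hp).2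
    _ = P.card * (M * (2 * S₀)) * ε'' := by rw [Finset.sum_const, nsmul_eq_mul]; ring
    _ ≤ ε := by
        rw [hε'', mul_div_assoc']
        rw [div_le_iff₀ hden]
        have := S₀_nonneg
        nlinarith [mul_nonneg (mul_nonneg (Nat.cast_nonneg P.card) (mul_nonneg hM (by positivity : (0:ℝ) ≤ 2 * S₀))) hε.le]

/-! # PART D1 — the sampling function `Q₀` with `𝓕Q₀|_ℤ = q·δ₀` -/

section Q0

/-- The smooth step `S(y) = smoothTransition(2y + 1/2)`: `0` for `y ≤ −1/4`, `1` for `y ≥ 1/4`. [folklore] -/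
def stepS (y : ℝ) : ℝ := Real.smoothTransition (2 * y + 1 / 2)

/-- `S` is smooth. [folklore] -/
theorem stepS_contDiff {n : ℕ∞} : ContDiff ℝ n stepS :=
  Real.smoothTransition.contDiff.comp ((contDiff_const.mul contDiff_id).add contDiff_const)

/-- `S = 0` on `(−∞, −1/4]`. [folklore] -/
theorem stepS_eq_zero {y : ℝ} (hy : y ≤ -(1 / 4)) : stepS y = 0 :=
  Real.smoothTransition.zero_of_nonpos (by linarith)

/-- `S = 1` on `[1/4, ∞)`. [folklore] -/
theorem stepS_eq_one {y : ℝ} (hy : 1 / 4 ≤ y) : stepS y = 1 :=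
  Real.smoothTransition.one_of_one_le (by linarith)

/-- `S` is monotone. [folklore] -/
theorem stepS_monotone : Monotone stepS := fun a b hab =>
  Real.smoothTransition.monotone (by linarith)

/-- The real sampling function `Q₀(x) = S(x + 1/2) − S(x − 1/2)`. [folklore] -/
def Q₀r (x : ℝ) : ℝ := stepS (x + 1 / 2) - stepS (x - 1 / 2)

/-- The (complexified) sampling function `Q₀`. [folklore] -/
def Q₀ (x : ℝ) : ℂ := ((Q₀r x : ℝ) : ℂ)

/-- `Q₀r` is smooth. [folklore] -/
theorem Q₀r_contDiff {n : ℕ∞} : ContDiff ℝ n Q₀r :=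
  (stepS_contDiff.comp (contDiff_id.add contDiff_const)).sub
    (stepS_contDiff.comp (contDiff_id.sub contDiff_const))

/-- `Q₀` is `C²`. [folklore] -/
theorem Q₀_contDiff : ContDiff ℝ 2 Q₀ :=
  (ofRealCLM.contDiff.of_le le_top).comp (Q₀r_contDiff (n := 2))

/-- `Q₀r` vanishes for `|x| ≥ 3/4`. [folklore] -/
theorem Q₀r_eq_zero {x : ℝ} (hx : 3 / 4 ≤ |x|) : Q₀r x = 0 := by
  rcases le_abs'.1 hx with h | h
  · rw [Q₀r, stepS_eq_zero (by linarith), stepS_eq_zero (by linarith), sub_self]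
  · rw [Q₀r, stepS_eq_one (by linarith), stepS_eq_one (by linarith), sub_self]

/-- `Q₀r` has compact support. [folklore] -/
theorem Q₀r_hasCompactSupport : HasCompactSupport Q₀r := by
  refine HasCompactSupport.intro (isCompact_closedBall (0 : ℝ) (3 / 4)) fun x hx => ?_
  rw [Metric.mem_closedBall, dist_zero_right, Real.norm_eq_abs, not_le] at hx
  exact Q₀r_eq_zero hx.le

/-- `Q₀` has compact support. [folklore] -/
theorem Q₀_hasCompactSupport : HasCompactSupport Q₀ := by
  refine HasCompactSupport.intro (isCompact_closedBall (0 : ℝ) (3 / 4)) fun x hx => ?_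
  rw [Metric.mem_closedBall, dist_zero_right, Real.norm_eq_abs, not_le] at hx
  rw [Q₀, Q₀r_eq_zero hx.le, Complex.ofReal_zero]

/-- `Q₀r ≥ 0`. [folklore] -/
theorem Q₀r_nonneg (x : ℝ) : 0 ≤ Q₀r x := by
  rw [Q₀r, sub_nonneg]; exact stepS_monotone (by linarith)

/-- `Q₀r 0 = 1`. [folklore] -/
theorem Q₀r_zero : Q₀r 0 = 1 := by
  rw [Q₀r, zero_add, zero_sub, stepS_eq_one (by norm_num), stepS_eq_zero (by norm_num), sub_zero]

/-- **`𝓕Q₀(0) ≠ 0`** (it is the positive number `∫ Q₀`). [folklore] -/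
theorem fourier_Q₀_zero_ne : 𝓕 Q₀ 0 ≠ 0 := by
  have hcont : Continuous Q₀r := (Q₀r_contDiff (n := 0)).continuous
  have hpos : 0 < ∫ x, Q₀r x :=
    hcont.integral_pos_of_hasCompactSupport_nonneg_nonzero Q₀r_hasCompactSupport
      Q₀r_nonneg (x := 0) (by rw [Q₀r_zero]; exact one_ne_zero)
  rw [Real.fourier_real_eq]
  simp only [mul_zero, neg_zero, AddChar.map_zero_eq_one, one_smul]
  rw [show (fun v : ℝ => Q₀ v) = fun v => ((Q₀r v : ℝ) : ℂ) from rfl, integral_complex_ofReal]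
  exact_mod_cast hpos.ne'

end Q0

/-- Anchor of this helper file (registered obligation): the sampling function is nonnegative. [folklore] -/
theorem rodLemmaD_anchor : ∀ x : ℝ, 0 ≤ Q₀r x := Q₀r_nonneg

end Summit.AtomisticToContinuum.Crystallization.Theorems.SignedRootRodLemma

end
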